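import Mathlib
import Literature.Analysis.UnboundedOperators.HeatKernelBoundedData
import Summits.NavierStokesRegularity.NavierStokesRegularity.Theorems.ThreadingFluxHorizonTowerDefs
import HarnessLib

/-!
# Crux `PoloidalLiouville` (stmt-NavierStokesRegularity-1222, W1), crux idea «precession-gap» (ns-idea-15):
# OSEEN ETERNAL LIOUVILLE — statement (I) `OseenEternalLiouville` of `Cruxes/PoloidalLiouville/PrecessionSketch.lean`,
# PROVED (body VERBATIM)

Support file (`--supports stmt-NavierStokesRegularity-1222`, helper).  Experiment cell `ns-wall-extremal`, width hand
ns-wall-eng-4 g3.  0 kit.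

THE STATEMENT ((I), «S, known — the bifurcation reading»): a bounded continuous ETERNAL honest-mild solution of the
LINEARISED equation at a constant drift `b`, i.e. `w(t) = e^{(t−s)Δ} w(s)(· − (t−s) b)` for all `s < t`, is constant in
space and time.  Hence no precessing or steady state bifurcates from the trivial family at any precession rate.

PROOF.  Space: for `τ > 0`, `w(t, ·) = (e^{τΔ} w(t−τ))(· − τ b)` and the sup-norm gradient estimate (Literature
`norm_fderiv_heatExtension_le_of_bounded`: `‖∇(e^{τΔ}f)‖ ≤ 2^{n/2} τ^{−1/2} B` for `‖f‖ ≤ B`) with the mean value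
inequality gives `‖w(t,x) − w(t,y)‖ ≤ 2^{3/2} τ^{−1/2} B ‖x − y‖ → 0` (`τ → ∞`).  Time: the slices are constants
`c(s)`, and `e^{τΔ} c = c` (Literature `heatExtension_const`), so `c(t) = c(s)`.

HONEST FRAME: a linear Liouville theorem (heat semigroup with drift); the precession RUNGS (D, F, G, P3) are untouched;
`PoloidalLiouville` (1222) and NS regularity stay OPEN.

## References
* planner ns-idea-15, `Cruxes/PoloidalLiouville/PrecessionSketch.lean` ((I) `OseenEternalLiouville`).
* Y. Giga, M.-H. Giga, J. Saal, *Nonlinear PDEs — asymptotic behavior of solutions and self-similar solutions* (2010),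
  §1.1.3 (derivative estimates for the heat semigroup). [GigaGigaSaal2010]
-/

-- the summit and its single problem share the name (D-0017 nested layout)
set_option linter.dupNamespace false

noncomputable section

namespace Summit.NavierStokesRegularity.NavierStokesRegularity.Theorems.PoloidalLiouville.Precession

open Set Function Filter Topology MeasureTheory
open scoped Topology RealInnerProductSpace
open Literature.Analysis.UnboundedOperators
open Summit.NavierStokesRegularity.NavierStokesRegularity.Theorems.PoloidalLiouville.HorizonTower (E3)

/-- **OSEEN ETERNAL LIOUVILLE** (body of the sketch's `OseenEternalLiouville`, VERBATIM): a bounded continuous eternal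
honest-mild solution of the linearised equation at a constant drift `b`,
`w(t) = e^{(t−s)Δ} w(s)(· − (t − s) b)` for all `s < t`, is constant in space and time.
[cite: GigaGigaSaal2010, §1.1.3] -/
theorem oseenEternalLiouville :
    ∀ (w : ℝ → E3 → E3) (b : E3) (B : ℝ), Continuous (uncurry w) → (∀ t x, ‖w t x‖ ≤ B) →
    (∀ s t : ℝ, s < t → ∀ x, w t x = heatExtension (w s) (t - s) (x - (t - s) • b)) →
    ∀ s t x y, w s x = w t y := by
  intro w b B hcont hbd hmild
  have hslice : ∀ s, Continuous (w s) := fun s =>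
    hcont.comp (continuous_const.prodMk continuous_id : Continuous fun x : E3 => (s, x))
  -- SPACE: every slice is constant
  have hspace : ∀ t x y, w t x = w t y := by
    intro t x y
    set A : ℝ := (2 : ℝ) ^ ((Module.finrank ℝ E3 : ℝ) / 2) with hA
    -- the distance is bounded by `A τ^{-1/2} B ‖x − y‖` for every `τ > 0`
    have hbound : ∀ τ : ℝ, 0 < τ → ‖w t x - w t y‖ ≤ A * τ ^ (-(1 / 2 : ℝ)) * B * ‖x - y‖ := by
      intro τ hτ
      set g : E3 → E3 := heatExtension (w (t - τ)) τ with hg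
      have hmem : MemLp (w (t - τ)) ⊤ (volume : Measure E3) :=
        memLp_top_of_continuous_of_bound (hslice _) (fun z => hbd _ z)
      have hdiff : ∀ z : E3, DifferentiableAt ℝ g z := fun z =>
        (hasFDerivAt_heatExtension hmem le_top hτ z).differentiableAt
      have hgrad : ∀ z : E3, ‖fderiv ℝ g z‖ ≤ A * τ ^ (-(1 / 2 : ℝ)) * B := fun z =>
        norm_fderiv_heatExtension_le_of_bounded (hslice (t - τ)).aestronglyMeasurable (fun z => hbd _ z) hτ z
      have hmv := convex_univ.norm_image_sub_le_of_norm_fderiv_le (f := g) (fun z _ => hdiff z)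
        (fun z _ => hgrad z) (mem_univ (y - τ • b)) (mem_univ (x - τ • b))
      have hx' : w t x = g (x - τ • b) := by
        have h := hmild (t - τ) t (by linarith) x
        rw [show t - (t - τ) = τ by ring] at h
        exact h
      have hy' : w t y = g (y - τ • b) := by
        have h := hmild (t - τ) t (by linarith) y
        rw [show t - (t - τ) = τ by ring] at h
        exact h
      rw [hx', hy']
      have hdist : ‖(x - τ • b) - (y - τ • b)‖ = ‖x - y‖ := by congr 1; abel
      rw [hdist] at hmv
      exact hmv
    -- let `τ → ∞`
    have hlim : Tendsto (fun τ : ℝ => A * τ ^ (-(1 / 2 : ℝ)) * B * ‖x - y‖) atTop (𝓝 0) := by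
      have h := (tendsto_rpow_neg_atTop (by norm_num : (0 : ℝ) < 1 / 2)).const_mul A
      have h2 := (h.mul_const B).mul_const ‖x - y‖
      simpa using h2
    have hle : ‖w t x - w t y‖ ≤ 0 :=
      ge_of_tendsto hlim (by
        filter_upwards [eventually_gt_atTop (0 : ℝ)] with τ hτ using hbound τ hτ)
    exact sub_eq_zero.mp (norm_eq_zero.mp (le_antisymm hle (norm_nonneg _)))
  -- TIME: the constants agree
  have htime : ∀ s t, s < t → ∀ x y, w s x = w t y := by
    intro s t hst x y
    have h := hmild s t hst y
    have hconst : w s = fun _ => w s x := funext fun z => hspace s z x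
    rw [hconst, heatExtension_const _ (by linarith)] at h
    exact h.symm
  intro s t x y
  rcases lt_trichotomy s t with h | h | h
  · exact htime s t h x y
  · subst h; exact hspace s x y
  · exact (htime t s h y x).symm

end Summit.NavierStokesRegularity.NavierStokesRegularity.Theorems.PoloidalLiouville.Precession

end
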